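import Summits.BirchSwinnertonDyer.BirchSwinnertonDyer.Theorems.SylvesterTwoHeegnerIndexYinPointOfOnePoint
import Summits.BirchSwinnertonDyer.BirchSwinnertonDyer.Theorems.SylvesterTwoHeegnerIndexThmCCubicTwistDescentHSY
import Literature.NumberTheory.EllipticCurves.HeegnerPointsGaloisDescent
import HarnessLib

/-!
# Route `SylvesterTwoHeegnerIndex` (rung K7t): the DESCENT LAYER of THEOREM C′ made kernel —
# `2`-divisibility in `E(K)` from an odd multiple that is twice a Galois-fixed-mod-torsion point of `E(𝔽)`

HONEST FRAMING (cell b2b-bsdres, seat x1b GEN 53 = O12 class lead; file `--supports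
stmt-BirchSwinnertonDyer-19802`; C′ and THEOREM C stay OPEN here; nothing in this file is a mechanism, a
definition or a named fact). bsd-cm-two's THEOREM C′ (MEMO-bsd-cm-two v2.10 §51–§52, referee g43 PASS on
(S1)–(S5), planner D142: CELL THEOREM at paper level modulo [Yin] Thm 2.2) ends with two purely algebraic
steps which planner D142 (b) requires PROVED in the kernel, not assumed:

* (S2)/(C2) the odd trace: `N·Z_p = −[ζ](R + σ̃R)` in `E_p(𝔽)` modulo torsion, `N` ODD, where `R` (a trace
  over an odd transversal) is Galois-fixed modulo torsion and the anti-trace `R − σ̃R` is torsion by the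
  toric vanishing (S3)/(S4);
* (S5) + DESCENT `𝔽 → K`: `E_p(𝔽)[2] = 0` (memo (B4)), so every torsion point met has ODD order; an odd
  multiple of `R` is then Galois-fixed on the nose, comes from `E_p(K)` (Galois descent for points, tree
  `exists_map_eq_of_forall_map_galois_eq`), and an ODD multiple of `Z_p` is `2•(point of E_p(K))`, whence
  `Z_p ∈ 2E_p(K)`.

This file proves that layer for ANY Weierstrass model `W/ℚ`, ANY Galois extension `𝔽/K` of fields of
characteristic `0` (finite where a product over `Gal(𝔽/K)` is taken) and ANY additive Galois-equivariant
`θ` (the CM action `[ζ]`, x1b [158] `exists_rootMulEquiv`), and plugs it into x1b [160]'s consumer: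

* §1 torsion bookkeeping in an abelian group: no `2`-torsion ⇒ finite orders are odd; odd multiple `= 2•W`
  ⇒ `2`-divisible;
* §2 the Galois action on `W(𝔽)` (Mathlib `Affine.Point.map ↑σ`): it fixes `W(K)`, is multiplicative,
  and «fixed modulo torsion» passes from `G′ ∪ σ̃G′` to all of `Gal(𝔽/K)`;
* §3 **`exists_eq_two_smul_of_odd_nsmul_laws`** (explicit odd exponents) and
  **`exists_eq_two_smul_of_torsion_laws`** (`W(𝔽)[2] = 0`, finite-order hypotheses): `Z ∈ W(K)`,
  `S ∈ W(𝔽)`, `N` odd, `N•ι Z − 2•S` torsion, `σS − S` torsion for all `σ` ⟹ **`Z = 2•Z′` in `W(K)`**;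
* §4 the trace currency of the memo: `exists_eq_two_smul_of_traceLaws` (from (C2) mod torsion, the
  anti-trace torsion, `R` Galois-fixed mod torsion, `θ` additive and Galois-equivariant), the exact trace
  identity `card • ι Z = −θ(R + σ̃R)` from (C1) `ι Z = −θ(w + σ̃w)` over a family commuting with `σ̃`
  (`smul_map_eq_neg_map_sum_of_commute`), and «`τR − R` torsion» from a transversal relation
  (`isOfFinAddOrder_map_sum_sub_sum_of_perm`);
* §5 (B4) in field form: `B(𝔽)[2] = 0` for any model `B ≅ E_n` over a field in which `2n²` is not a
  cube (`eq_zero_of_two_nsmul_eq_zero_of_variableChange`; memo (B4): «a `2`-torsion point of `E_p` needs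
  `∛(2p²) ∈ 𝔽`»). The consumers (hOneK datum of x1b [160], C′, item 19802 BY NAME) are in the sibling
  file `…YinPointOfToricDescent`.

So two g10's `twoDivisible_of_toric : PublishedFactsTwoYinToric → …` (D139 (a)/D142 (b)) needs from the
typed package only the objects and the CM/automorphic statements (T2CM)/(TS)/(B4); the algebra below them
is kernel. NO definition, NO named fact, NO sorry; axioms standard; closes no item; nothing booked.
References: MEMO-bsd-cm-two v2.10 (FROZEN 08c1ecd6da1b763f) §52.3 (B4)/(B5), §52.4 (C1)/(C2), §52.7;
referee/REFEREE-COUNTERSIGN-TWO-V210-G43.md; pub/bsd-cm STATUS D139 (a), D142 (b); Yin, arXiv:2607.01744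
Thm 2.2 (PRE); Silverman AEC VIII.§1 (Galois descent).
-/

set_option autoImplicit false
-- the Summit-side namespace `Summit.BirchSwinnertonDyer.BirchSwinnertonDyer.…` (summit = problem) is mandated by D-0017
set_option linter.dupNamespace false

noncomputable section

open scoped Classical

open WeierstrassCurve WeierstrassCurve.Affine WeierstrassCurve.Affine.Point
open Summit.BirchSwinnertonDyer.BirchSwinnertonDyer.Theorems.SylvesterTwoYin
  Summit.BirchSwinnertonDyer.BirchSwinnertonDyer.Theorems.SylvesterTwoYinOnePoint
  Summit.BirchSwinnertonDyer.BirchSwinnertonDyer.Theorems.SylvesterTwoThmCTwist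
  Literature.NumberTheory.EllipticCurves Literature.NumberTheory.EllipticCurves.HuShuYin2019

namespace Summit.BirchSwinnertonDyer.BirchSwinnertonDyer.Theorems.SylvesterTwoYinToricDescent

/-! ## §1 Torsion bookkeeping in an abelian group -/

section Torsion

variable {M : Type*} [AddCommGroup M]

/-- **No `2`-torsion ⇒ every element of finite order has ODD order** (if `ord T = 2j` then `j•T` is
killed by `2`, hence `0`, contradicting minimality). Memo (B4): `E_p(𝔽)[2] = 0 ⇒ E_p(𝔽)_tors` has odd
order. [folklore] -/
theorem odd_addOrderOf_of_forall_two_nsmul_eq_zero (h2 : ∀ T : M, (2 : ℕ) • T = 0 → T = 0) {T : M}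
    (hT : IsOfFinAddOrder T) : Odd (addOrderOf T) := by
  rcases Nat.even_or_odd (addOrderOf T) with ⟨j, hj⟩ | h
  · exfalso
    have hpos : 0 < addOrderOf T := hT.addOrderOf_pos
    have hjT : j • T = 0 := h2 _ (by rw [two_nsmul, ← add_nsmul, ← hj]; exact addOrderOf_nsmul_eq_zero T)
    have hdvd : addOrderOf T ∣ j := addOrderOf_dvd_of_nsmul_eq_zero hjT
    have hj0 : 0 < j := by omega
    have hle := Nat.le_of_dvd hj0 hdvd
    omega
  · exact h

/-- **An ODD multiple that is `2•W` is `2•Z′`**: `N = 2k + 1`, `Z = N•Z − 2k•Z = 2•(W − k•Z)`.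
(x1b [160] `exists_eq_two_smul_add_torsion_of_odd_smul` is the version with a torsion term.) [folklore] -/
theorem exists_eq_two_smul_of_odd_smul_eq_two_smul {N : ℤ} (hN : Odd N) {Z W : M}
    (h : N • Z = (2 : ℤ) • W) : ∃ Z' : M, Z = (2 : ℤ) • Z' := by
  obtain ⟨k, rfl⟩ := hN
  refine ⟨W - k • Z, ?_⟩
  symm
  calc (2 : ℤ) • (W - k • Z) = (2 : ℤ) • W - (2 * k) • Z := by rw [smul_sub, mul_smul]
    _ = (2 * k + 1) • Z - (2 * k) • Z := by rw [h]
    _ = Z := by rw [← sub_smul, add_sub_cancel_left, one_smul]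

/-- In a group without `2`-torsion, `2•Z′ + T′` with `T′` torsion is `2•Z″` on the nose (`T′` has odd
order `2k + 1`, so `T′ = −2k•T′ = 2•(−k•T′)`); conversely `Z = 2•Z′` is trivially `2•Z′ + 0`. Recorded so
that both currencies of «`2`-divisible modulo torsion» interchange. [folklore] -/
theorem exists_eq_two_smul_of_eq_two_smul_add_torsion (h2 : ∀ T : M, (2 : ℕ) • T = 0 → T = 0)
    {Z Z' T' : M} (hT' : IsOfFinAddOrder T') (h : Z = (2 : ℤ) • Z' + T') :
    ∃ Z'' : M, Z = (2 : ℤ) • Z'' := by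
  obtain ⟨k, hk⟩ := odd_addOrderOf_of_forall_two_nsmul_eq_zero h2 hT'
  refine ⟨Z' - (k : ℤ) • T', ?_⟩
  have hkT : T' + (2 * (k : ℤ)) • T' = 0 := by
    have e : ((2 * k + 1 : ℕ) : ℤ) • T' = 0 := by
      rw [natCast_zsmul, ← hk]; exact addOrderOf_nsmul_eq_zero T'
    rwa [Nat.cast_add, Nat.cast_mul, Nat.cast_two, Nat.cast_one, add_smul, one_smul, add_comm] at e
  rw [h, smul_sub, smul_smul, sub_eq_add_neg, add_right_inj, eq_neg_iff_add_eq_zero]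
  exact hkT

end Torsion

/-! ## §2 The Galois action on `W(𝔽)`: it fixes `W(K)`, is multiplicative, «fixed mod torsion» spreads
from `G′ ∪ σ̃G′` -/

section Galois

variable {K : Type*} [Field K] [CharZero K] {F : Type*} [Field F] [CharZero F] [Algebra K F]
  (W : WeierstrassCurve ℚ)

/-- `Gal(𝔽/K)` fixes the image of `W(K)` in `W(𝔽)` (coordinates in `K`). [folklore] -/
theorem map_galois_map_algebraMap (σ : F ≃ₐ[K] F) (P₀ : (W.baseChange K).toAffine.Point) :
    Affine.Point.map (σ : F →ₐ[K] F) (Affine.Point.map (algebraMap K F).toRatAlgHom P₀) =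
      Affine.Point.map (algebraMap K F).toRatAlgHom P₀ := by
  rcases P₀ with _ | ⟨x, y, h⟩
  · rfl
  · simp only [Affine.Point.map_some, Affine.Point.some.injEq, RingHom.toRatAlgHom_apply]
    exact ⟨(σ : F →ₐ[K] F).commutes x, (σ : F →ₐ[K] F).commutes y⟩

/-- `στ` acts on points as `σ ∘ τ`. [folklore] -/
theorem map_galois_mul (σ τ : F ≃ₐ[K] F) (P : (W.baseChange F).toAffine.Point) :
    Affine.Point.map ((σ * τ : F ≃ₐ[K] F) : F →ₐ[K] F) P =
      Affine.Point.map (σ : F →ₐ[K] F) (Affine.Point.map (τ : F →ₐ[K] F) P) := by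
  rcases P with _ | ⟨x, y, h⟩ <;> rfl

/-- **«Galois-fixed modulo torsion» spreads over cosets.** If every `τ ∈ Gal(𝔽/K)` lies in `G′` or in
`σ̃G′` (memo: `G′ = Gal(𝔽/K(i))` of index `2`, `σ̃|_{K(i)} = c`), and `τR − R` is torsion for `τ ∈ G′`
(the trace, (S2)) and for `τ = σ̃` (the anti-trace, (S3)/(S4)), then `τR − R` is torsion for every `τ`:
`σ̃τ′R − R = σ̃(τ′R − R) + (σ̃R − R)`. [folklore] -/
theorem isOfFinAddOrder_map_sub_of_cosets (G' : Set (F ≃ₐ[K] F)) (σ' : F ≃ₐ[K] F)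
    (R : (W.baseChange F).toAffine.Point)
    (hgen : ∀ τ : F ≃ₐ[K] F, τ ∈ G' ∨ ∃ τ' ∈ G', τ = σ' * τ')
    (hG' : ∀ τ ∈ G', IsOfFinAddOrder (Affine.Point.map (τ : F →ₐ[K] F) R - R))
    (hσ' : IsOfFinAddOrder (Affine.Point.map (σ' : F →ₐ[K] F) R - R)) (τ : F ≃ₐ[K] F) :
    IsOfFinAddOrder (Affine.Point.map (τ : F →ₐ[K] F) R - R) := by
  rcases hgen τ with hτ | ⟨τ', hτ', rfl⟩
  · exact hG' τ hτ
  · have e : Affine.Point.map ((σ' * τ' : F ≃ₐ[K] F) : F →ₐ[K] F) R - R =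
        Affine.Point.map (σ' : F →ₐ[K] F) (Affine.Point.map (τ' : F →ₐ[K] F) R - R) +
          (Affine.Point.map (σ' : F →ₐ[K] F) R - R) := by
      rw [map_galois_mul, map_sub]; abel
    rw [e]
    exact ((Affine.Point.map (σ' : F →ₐ[K] F)).isOfFinAddOrder (hG' τ' hτ')).add hσ'

end Galois

/-! ## §3 DESCENT OF `2`-DIVISIBILITY: an odd multiple of `Z ∈ W(K)` that is `2•S` modulo torsion for a
Galois-fixed-mod-torsion `S ∈ W(𝔽)` forces `Z ∈ 2W(K)` -/

section Descent

variable {K : Type*} [Field K] [CharZero K] {F : Type*} [Field F] [CharZero F] [Algebra K F]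
  (W : WeierstrassCurve ℚ)

/-- **DESCENT OF `2`-DIVISIBILITY, explicit odd exponents.** `𝔽/K` Galois of characteristic `0`, `W/ℚ`;
`Z ∈ W(K)`, `S ∈ W(𝔽)`, `N` odd, and odd `n, m` with `n•(N•ι Z − 2•S) = 0` and `m•(σS − S) = 0` for all
`σ ∈ Gal(𝔽/K)`. Then `Z = 2•Z′` for some `Z′ ∈ W(K)`: `m•S` is Galois-fixed, so `m•S = ι Y₀` with
`Y₀ ∈ W(K)` (tree `exists_map_eq_of_forall_map_galois_eq`); `(nm·N)•ι Z = 2•(n•ι Y₀)`, `ι` is injective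
(Mathlib `Affine.Point.map_injective`), and `nm·N` is odd (§1). Memo §52.7 with (B4)/(S5).
[cite: SilvermanAEC2009, VIII.§1] -/
theorem exists_eq_two_smul_of_odd_nsmul_laws [IsGalois K F] {Z : (W.baseChange K).toAffine.Point}
    {S : (W.baseChange F).toAffine.Point} {N : ℤ} (hN : Odd N) {n m : ℕ} (hn : Odd n) (hm : Odd m)
    (hZ : n • (N • Affine.Point.map (algebraMap K F).toRatAlgHom Z - (2 : ℤ) • S) = 0)
    (hS : ∀ σ : F ≃ₐ[K] F, m • (Affine.Point.map (σ : F →ₐ[K] F) S - S) = 0) :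
    ∃ Z' : (W.baseChange K).toAffine.Point, Z = (2 : ℤ) • Z' := by
  -- `m • S` is Galois-fixed, hence comes from `W(K)`
  have hfix : ∀ σ : F ≃ₐ[K] F, Affine.Point.map (σ : F →ₐ[K] F) (m • S) = m • S := fun σ => by
    have h := hS σ
    rw [smul_sub, sub_eq_zero, ← map_nsmul] at h
    exact h
  obtain ⟨Y₀, hY₀⟩ := exists_map_eq_of_forall_map_galois_eq W hfix
  -- `(n*m*N) • Z = 2 • ((n*m) • Y₀)`... computed inside `W(𝔽)` and pulled back along the injective `ι`
  have hinj := Affine.Point.map_injective (W' := W) (f := (algebraMap K F).toRatAlgHom)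
  have hZ' : ((n : ℤ) * N) • Affine.Point.map (algebraMap K F).toRatAlgHom Z = ((n : ℤ) * 2) • S := by
    rw [smul_sub, sub_eq_zero] at hZ
    simpa only [← natCast_zsmul, smul_smul] using hZ
  have key : (((m * n : ℕ) : ℤ) * N) • Z = (2 : ℤ) • ((n : ℤ) • Y₀) := by
    apply hinj
    rw [map_zsmul, map_zsmul, map_zsmul, hY₀, ← natCast_zsmul S m, Nat.cast_mul, mul_assoc, mul_smul, hZ']
    simp only [smul_smul]
    congr 1
    ring
  have hodd : Odd (((m * n : ℕ) : ℤ) * N) := (Int.odd_coe_nat _ |>.mpr (hm.mul hn)).mul hN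
  exact exists_eq_two_smul_of_odd_smul_eq_two_smul hodd key

/-- **DESCENT OF `2`-DIVISIBILITY** (finite Galois, `W(𝔽)[2] = 0`). `𝔽/K` finite Galois of
characteristic `0`, `W/ℚ` with `W(𝔽)[2] = 0` (memo (B4)); `Z ∈ W(K)`, `S ∈ W(𝔽)`, `N` odd with
`N•ι Z − 2•S` TORSION and `σS − S` TORSION for every `σ ∈ Gal(𝔽/K)`. THEN `Z = 2•Z′` in `W(K)`. (All the
torsion met has odd order by §1; take `n = ord(N•ι Z − 2•S)`, `m = ∏_σ ord(σS − S)`.) This is (S5) + the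
descent `𝔽 → K` of THEOREM C′ (memo §52.7) for `S = −[ζ]R`. [cite: SilvermanAEC2009, VIII.§1] -/
theorem exists_eq_two_smul_of_torsion_laws [IsGalois K F] [FiniteDimensional K F]
    (h2 : ∀ T : (W.baseChange F).toAffine.Point, (2 : ℕ) • T = 0 → T = 0)
    {Z : (W.baseChange K).toAffine.Point} {S : (W.baseChange F).toAffine.Point} {N : ℤ} (hN : Odd N)
    (hZ : IsOfFinAddOrder (N • Affine.Point.map (algebraMap K F).toRatAlgHom Z - (2 : ℤ) • S))
    (hS : ∀ σ : F ≃ₐ[K] F, IsOfFinAddOrder (Affine.Point.map (σ : F →ₐ[K] F) S - S)) :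
    ∃ Z' : (W.baseChange K).toAffine.Point, Z = (2 : ℤ) • Z' := by
  refine exists_eq_two_smul_of_odd_nsmul_laws W hN
    (n := addOrderOf (N • Affine.Point.map (algebraMap K F).toRatAlgHom Z - (2 : ℤ) • S))
    (m := ∏ σ : F ≃ₐ[K] F, addOrderOf (Affine.Point.map (σ : F →ₐ[K] F) S - S))
    (odd_addOrderOf_of_forall_two_nsmul_eq_zero h2 hZ) ?_ (addOrderOf_nsmul_eq_zero _) fun σ => ?_
  · exact Finset.prod_induction _ Odd (fun a b ha hb => ha.mul hb) odd_one
      fun σ _ => odd_addOrderOf_of_forall_two_nsmul_eq_zero h2 (hS σ)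
  · obtain ⟨k, hk⟩ : addOrderOf (Affine.Point.map (σ : F →ₐ[K] F) S - S) ∣
        ∏ τ : F ≃ₐ[K] F, addOrderOf (Affine.Point.map (τ : F →ₐ[K] F) S - S) :=
      Finset.dvd_prod_of_mem _ (Finset.mem_univ σ)
    rw [hk, mul_nsmul, addOrderOf_nsmul_eq_zero, nsmul_zero]

/-- The same in the interface currency of x1b [160] (`Y = 2•Y′ + T′`, `T′` torsion — here `T′ = 0`).
[cite: SilvermanAEC2009, VIII.§1] -/
theorem exists_eq_two_smul_add_torsion_of_torsion_laws [IsGalois K F] [FiniteDimensional K F]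
    (h2 : ∀ T : (W.baseChange F).toAffine.Point, (2 : ℕ) • T = 0 → T = 0)
    {Z : (W.baseChange K).toAffine.Point} {S : (W.baseChange F).toAffine.Point} {N : ℤ} (hN : Odd N)
    (hZ : IsOfFinAddOrder (N • Affine.Point.map (algebraMap K F).toRatAlgHom Z - (2 : ℤ) • S))
    (hS : ∀ σ : F ≃ₐ[K] F, IsOfFinAddOrder (Affine.Point.map (σ : F →ₐ[K] F) S - S)) :
    ∃ Z' T' : (W.baseChange K).toAffine.Point, IsOfFinAddOrder T' ∧ Z = (2 : ℤ) • Z' + T' := by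
  obtain ⟨Z', hZ'⟩ := exists_eq_two_smul_of_torsion_laws W h2 hN hZ hS
  exact ⟨Z', 0, IsOfFinAddOrder.zero, by rw [hZ', add_zero]⟩

end Descent

/-! ## §4 The trace currency of the memo: (C1) ⇒ (C2), the transversal, the anti-trace -/

section Trace

variable {K : Type*} [Field K] [CharZero K] {F : Type*} [Field F] [CharZero F] [Algebra K F]
  (W : WeierstrassCurve ℚ)

/-- **FROM THE TRACE LAWS TO `Z = 2•Z′`.** `𝔽/K` finite Galois (char `0`), `W(𝔽)[2] = 0`, `θ` an additive
Galois-equivariant map of `W(𝔽)` (the CM action `−[ζ]`, or `[ζ]`: sign immaterial), `Z ∈ W(K)`,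
`R ∈ W(𝔽)`, `σ̃ ∈ Gal(𝔽/K)`, `N` odd with (C2) `N•ι Z + θ(R + σ̃R)` TORSION, the ANTI-TRACE `R − σ̃R`
TORSION ((S3)/(S4): the coherent toric period vanishes) and `τR − R` TORSION for all `τ` ((S2): `R` is a
trace). THEN `Z = 2•Z′` in `W(K)` — §3 with `S = −θR`: `N•ι Z − 2•S = [N•ι Z + θ(R + σ̃R)] + θ(R − σ̃R)`.
Memo §52.4 (C2) + §52.7. [cite: SilvermanAEC2009, VIII.§1] -/
theorem exists_eq_two_smul_of_traceLaws [IsGalois K F] [FiniteDimensional K F]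
    (h2 : ∀ T : (W.baseChange F).toAffine.Point, (2 : ℕ) • T = 0 → T = 0)
    (θ : (W.baseChange F).toAffine.Point →+ (W.baseChange F).toAffine.Point)
    (hθ : ∀ (τ : F ≃ₐ[K] F) (P : (W.baseChange F).toAffine.Point),
      Affine.Point.map (τ : F →ₐ[K] F) (θ P) = θ (Affine.Point.map (τ : F →ₐ[K] F) P))
    {Z : (W.baseChange K).toAffine.Point} {R : (W.baseChange F).toAffine.Point} (σ' : F ≃ₐ[K] F)
    {N : ℤ} (hN : Odd N)
    (hC2 : IsOfFinAddOrder (N • Affine.Point.map (algebraMap K F).toRatAlgHom Z +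
      θ (R + Affine.Point.map (σ' : F →ₐ[K] F) R)))
    (hanti : IsOfFinAddOrder (R - Affine.Point.map (σ' : F →ₐ[K] F) R))
    (hR : ∀ τ : F ≃ₐ[K] F, IsOfFinAddOrder (Affine.Point.map (τ : F →ₐ[K] F) R - R)) :
    ∃ Z' : (W.baseChange K).toAffine.Point, Z = (2 : ℤ) • Z' := by
  refine exists_eq_two_smul_of_torsion_laws W h2 hN (S := -θ R) ?_ fun τ => ?_
  · have e : N • Affine.Point.map (algebraMap K F).toRatAlgHom Z - (2 : ℤ) • (-θ R) =
        (N • Affine.Point.map (algebraMap K F).toRatAlgHom Z + θ (R + Affine.Point.map (σ' : F →ₐ[K] F) R)) +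
          θ (R - Affine.Point.map (σ' : F →ₐ[K] F) R) := by
      rw [map_add, map_sub, smul_neg, two_smul]; abel
    rw [e]
    exact hC2.add (θ.isOfFinAddOrder hanti)
  · have e : Affine.Point.map (τ : F →ₐ[K] F) (-θ R) - -θ R = -θ (Affine.Point.map (τ : F →ₐ[K] F) R - R) := by
      rw [map_neg, hθ, map_sub]; abel
    rw [e]
    exact (θ.isOfFinAddOrder (hR τ)).neg

/-- **(C1) ⇒ (C2), exactly.** Let `g : I → Gal(𝔽/K)` be a finite family commuting with `σ̃` (memo: `G`
is abelian — `𝔽 ⊂ K^{ab}`), `θ` additive and Galois-equivariant, and (C1) `ι Z = −θ(w + σ̃w)` (the `T₂`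
identity (A′) pushed to `E_p`, memo §52.4). Summing `g_i`(C1) over `i`: `|I|•ι Z = −θ(R + σ̃R)` with
`R := Σ_i g_i w` — each `g_i` fixes `ι Z`, and `Σ_i g_i σ̃ w = σ̃ R`. Memo §52.4 (C2) with `N = |I| = 9`.
[folklore] -/
theorem card_smul_map_eq_neg_map_sum {I : Type*} [Fintype I] (g : I → (F ≃ₐ[K] F)) (σ' : F ≃ₐ[K] F)
    (hcomm : ∀ i, g i * σ' = σ' * g i)
    (θ : (W.baseChange F).toAffine.Point →+ (W.baseChange F).toAffine.Point)
    (hθ : ∀ (τ : F ≃ₐ[K] F) (P : (W.baseChange F).toAffine.Point),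
      Affine.Point.map (τ : F →ₐ[K] F) (θ P) = θ (Affine.Point.map (τ : F →ₐ[K] F) P))
    (Z : (W.baseChange K).toAffine.Point) (w : (W.baseChange F).toAffine.Point)
    (hC1 : Affine.Point.map (algebraMap K F).toRatAlgHom Z = -θ (w + Affine.Point.map (σ' : F →ₐ[K] F) w)) :
    (Fintype.card I : ℤ) • Affine.Point.map (algebraMap K F).toRatAlgHom Z =
      -θ ((∑ i, Affine.Point.map (g i : F →ₐ[K] F) w) +
        Affine.Point.map (σ' : F →ₐ[K] F) (∑ i, Affine.Point.map (g i : F →ₐ[K] F) w)) := by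
  have hsum : ∑ i : I, Affine.Point.map (g i : F →ₐ[K] F) (Affine.Point.map (algebraMap K F).toRatAlgHom Z) =
      (Fintype.card I : ℤ) • Affine.Point.map (algebraMap K F).toRatAlgHom Z := by
    simp_rw [map_galois_map_algebraMap]
    rw [Finset.sum_const, Finset.card_univ, natCast_zsmul]
  rw [← hsum]
  simp_rw [hC1, map_neg, hθ, map_add, ← map_galois_mul, hcomm, map_galois_mul]
  rw [Finset.sum_neg_distrib, Finset.sum_add_distrib, ← map_sum, ← map_sum, ← map_sum]

/-- **(C1) modulo torsion ⇒ (C2) modulo torsion** (same bookkeeping, for providers who state the `T₂`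
identity up to torsion). [folklore] -/
theorem isOfFinAddOrder_card_smul_map_add_map_sum {I : Type*} [Fintype I] (g : I → (F ≃ₐ[K] F))
    (σ' : F ≃ₐ[K] F) (hcomm : ∀ i, g i * σ' = σ' * g i)
    (θ : (W.baseChange F).toAffine.Point →+ (W.baseChange F).toAffine.Point)
    (hθ : ∀ (τ : F ≃ₐ[K] F) (P : (W.baseChange F).toAffine.Point),
      Affine.Point.map (τ : F →ₐ[K] F) (θ P) = θ (Affine.Point.map (τ : F →ₐ[K] F) P))
    (Z : (W.baseChange K).toAffine.Point) (w : (W.baseChange F).toAffine.Point)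
    (hC1 : IsOfFinAddOrder
      (Affine.Point.map (algebraMap K F).toRatAlgHom Z + θ (w + Affine.Point.map (σ' : F →ₐ[K] F) w))) :
    IsOfFinAddOrder ((Fintype.card I : ℤ) • Affine.Point.map (algebraMap K F).toRatAlgHom Z +
      θ ((∑ i, Affine.Point.map (g i : F →ₐ[K] F) w) +
        Affine.Point.map (σ' : F →ₐ[K] F) (∑ i, Affine.Point.map (g i : F →ₐ[K] F) w))) := by
  have e : (Fintype.card I : ℤ) • Affine.Point.map (algebraMap K F).toRatAlgHom Z +
      θ ((∑ i, Affine.Point.map (g i : F →ₐ[K] F) w) +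
        Affine.Point.map (σ' : F →ₐ[K] F) (∑ i, Affine.Point.map (g i : F →ₐ[K] F) w)) =
      ∑ i, Affine.Point.map (g i : F →ₐ[K] F)
        (Affine.Point.map (algebraMap K F).toRatAlgHom Z + θ (w + Affine.Point.map (σ' : F →ₐ[K] F) w)) := by
    simp_rw [map_add, map_galois_map_algebraMap, hθ, ← map_galois_mul, hcomm, map_galois_mul]
    rw [Finset.sum_add_distrib, Finset.sum_const, Finset.card_univ, natCast_zsmul, Finset.sum_add_distrib,
      ← map_sum, ← map_sum, ← map_sum]
  rw [e]
  exact (AddCommGroup.torsion _).sum_mem fun i _ =>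
    (AddCommGroup.mem_torsion _).mpr ((Affine.Point.map (g i : F →ₐ[K] F)).isOfFinAddOrder hC1)

/-- **The trace over a transversal is Galois-fixed modulo torsion.** If `τ·g_i = g_{π i}` modulo an
element moving `w` by torsion (memo (B5): `τ g_i = g_{π(i)} h_i` with `h_i ∈ H`, `h_i w − w` torsion), i.e.
`(τ g_i)w − g_{π i} w` is torsion for a permutation `π`, then `τR − R` is torsion for `R = Σ_i g_i w`.
Memo §52.4 (C2) («`R ∈ V^{Gal(𝔽/K(i))}`»). [folklore] -/
theorem isOfFinAddOrder_map_sum_sub_sum_of_perm {I : Type*} [Fintype I] (g : I → (F ≃ₐ[K] F))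
    (w : (W.baseChange F).toAffine.Point) (τ : F ≃ₐ[K] F) (π : Equiv.Perm I)
    (h : ∀ i, IsOfFinAddOrder (Affine.Point.map ((τ * g i : F ≃ₐ[K] F) : F →ₐ[K] F) w -
      Affine.Point.map (g (π i) : F →ₐ[K] F) w)) :
    IsOfFinAddOrder (Affine.Point.map (τ : F →ₐ[K] F) (∑ i, Affine.Point.map (g i : F →ₐ[K] F) w) -
      ∑ i, Affine.Point.map (g i : F →ₐ[K] F) w) := by
  have e : Affine.Point.map (τ : F →ₐ[K] F) (∑ i, Affine.Point.map (g i : F →ₐ[K] F) w) -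
      ∑ i, Affine.Point.map (g i : F →ₐ[K] F) w =
      ∑ i, (Affine.Point.map ((τ * g i : F ≃ₐ[K] F) : F →ₐ[K] F) w -
        Affine.Point.map (g (π i) : F →ₐ[K] F) w) := by
    rw [Finset.sum_sub_distrib, map_sum,
      ← Equiv.sum_comp π (fun i => Affine.Point.map (g i : F →ₐ[K] F) w)]
    simp_rw [map_galois_mul]
  rw [e]
  exact (AddCommGroup.torsion _).sum_mem fun i _ => (AddCommGroup.mem_torsion _).mpr (h i)

end Trace

/-! ## §5 (B4) in field form: no `2`-torsion on a model of `E_n` over a field in which `2n²` is not a cube -/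

section NoTwoTorsion

variable {F : Type*} [Field F] [CharZero F]

/-- **No `2`-torsion on `y² = x³ − 432n²` over a field in which `2n²` is not a cube**: a point `Q` with
`2•Q = 0` is `𝒪` — else `Q = (x, 0)` with `x³ = 432n² = 6³·2n²`, `(x/6)³ = 2n²`. (x1b [157] §4 is the case
`n = 1`.) Memo (B4): «a `2`-torsion point of `E_p` needs `∛(2p²) ∈ 𝔽`». [cite: SilvermanAEC2009, III.2.3] -/
theorem eq_zero_of_two_nsmul_eq_zero_of_forall_pow_three_ne {W : WeierstrassCurve F} {n : F}
    (h1 : W.a₁ = 0) (h2 : W.a₂ = 0) (h3 : W.a₃ = 0) (h4 : W.a₄ = 0) (h6 : W.a₆ = -432 * n ^ 2)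
    (hcbrt : ∀ z : F, z ^ 3 ≠ 2 * n ^ 2) (Q : W.toAffine.Point) (hQ : (2 : ℕ) • Q = 0) : Q = 0 := by
  rcases Q with _ | ⟨x, y, h⟩
  · rfl
  · exfalso
    rw [two_nsmul, add_eq_zero_iff_eq_neg, Affine.Point.neg_some] at hQ
    simp only [Affine.Point.some.injEq, true_and, Affine.negY, h1, h3, zero_mul, sub_zero] at hQ
    have hy : y = 0 := by
      have e : (2 : F) * y = 0 := by linear_combination hQ
      rcases mul_eq_zero.mp e with e | e
      · norm_num at e
      · exact e
    have heq := h.left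
    rw [Affine.equation_iff] at heq
    simp only [h1, h2, h3, h4, h6, hy, zero_mul, mul_zero, add_zero] at heq
    apply hcbrt (x / 6)
    field_simp
    linear_combination -heq

/-- **(B4) for `E_n = cubeSumCurve n` over `𝔽`**: `2n²` not a cube in `𝔽` ⇒ `E_n(𝔽)[2] = 0`.
[cite: SilvermanAEC2009, III.2.3] -/
theorem cubeSumCurve_eq_zero_of_two_nsmul_eq_zero (n : ℚ) (hcbrt : ∀ z : F, z ^ 3 ≠ 2 * (n : F) ^ 2)
    (Q : ((cubeSumCurve n).baseChange F).toAffine.Point) (hQ : (2 : ℕ) • Q = 0) : Q = 0 :=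
  eq_zero_of_two_nsmul_eq_zero_of_forall_pow_three_ne (cubeSumCurve_baseChange_a₁ n)
    (cubeSumCurve_baseChange_a₂ n) (cubeSumCurve_baseChange_a₃ n) (cubeSumCurve_baseChange_a₄ n)
    (cubeSumCurve_baseChange_a₆ n) hcbrt Q hQ

/-- **(B4) for ANY model `B ≅ E_n` over `ℚ`** (the `h2` hypothesis of §3/§4 and of the consumers, for the
route's minimal models `B`): `2n²` not a cube in `𝔽` ⇒ `B(𝔽)[2] = 0`, transporting along the tree's
`VariableChange.pointEquivBaseChange` (`B(𝔽) ≃+ (C • B)(𝔽) = E_n(𝔽)`). [cite: SilvermanAEC2009, III.2.3] -/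
theorem eq_zero_of_two_nsmul_eq_zero_of_variableChange (n : ℚ) (hcbrt : ∀ z : F, z ^ 3 ≠ 2 * (n : F) ^ 2)
    (B : WeierstrassCurve ℚ) (C : VariableChange ℚ) (hC : C • B = cubeSumCurve n)
    (T : (B.baseChange F).toAffine.Point) (hT : (2 : ℕ) • T = 0) : T = 0 := by
  have hCF : (C • B).baseChange F = (cubeSumCurve n).baseChange F := by rw [hC]
  set ψ : (B.baseChange F).toAffine.Point ≃+ ((cubeSumCurve n).baseChange F).toAffine.Point :=
    (VariableChange.pointEquivBaseChange B C F).trans (Affine.Point.congrEquiv hCF)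
  have h := cubeSumCurve_eq_zero_of_two_nsmul_eq_zero n hcbrt (ψ T) (by rw [← map_nsmul, hT, _root_.map_zero])
  exact ψ.injective (h.trans (_root_.map_zero ψ).symm)

end NoTwoTorsion

end Summit.BirchSwinnertonDyer.BirchSwinnertonDyer.Theorems.SylvesterTwoYinToricDescent

end
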